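import Literature.MathematicalPhysics.QuantumFieldTheory.Balaban1983to89.B9Eq325QGGQInvZdPerLevels
import Literature.MathematicalPhysics.QuantumFieldTheory.Balaban1983to89.B9Eq325ProjContinuityZdPer
import Literature.MathematicalPhysics.QuantumFieldTheory.Balaban1983to89.B9Eq325ProjFormulaZdLevels

/-!
# `Balaban1983to89.B9Eq325ProjFormulaZdPerLevels` — [Balaban1985BackgroundPropagators] (3.25) `R(U₀) = I − G′Q′*(Q′G′²Q′*)⁻¹Q′G′` ON `L²(T_P, 𝔤)`, HERMITIAN INPUTS,
# AND THE CONTINUITY OF THE RECORD'S `R(U)` IN THE BACKGROUND, WITH THE AVERAGED TRANSPORTERS UNITARY ONLY UP TO THE TRUNCATION LEVEL `m` — the hypothesis-exact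
# edition of this seat's `B9Eq325ProjFormulaZdPer.coe_projRPer_eq_RopPer_of_herm` and `B9Eq325ProjContinuityZdPer.continuousAt_covDerivFwd_projRPer_covDivB`
# (which asked `Ū₀ʲ(Γ)` unitary at EVERY level `j`), so that the (β′-PERIODIC) road applies in [Balaban1985Averaging] Prop. 2's regime of a background controlled
# up to level `m` — the torus twin of the lineage's g3 `B9Eq325ProjFormulaZdLevels`

statement-level skeleton of published theorems with citation tags; proofs where landed; nothing here is a claim about the
Yang–Mills mass gap

`[Balaban1985BackgroundPropagators]` ("B9", CMP **99** (1985) 389–434) p. 394 (3.25): *«R(U) = I − G′(U)Q′*(U)(Q′(U)G′(U)²Q′*(U))⁻¹Q′(U)G′(U)»*, with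
(3.18)–(3.19) p. 393: *«Q′_j(U) = Q′(Ūʲ⁻¹)…Q′(Ū)Q′(U), j = 0, 1, …»* — only the averaged configurations below the truncation occur; (3.26) p. 395 *«D^η_U R(U) D^{η*}_U»*;
`[Balaban1985Averaging]` Prop. 2 p. 26 (unitarity of `Ūʲ` up to the level controlled); `[Balaban1985RegularSpaces]` p. 77 *«Ω_j = T_η»*.  PDF held:
`paper:balaban1985-cmp99-background-propagators` pp. 393–395 (re-read by this seat, 2026-08-28).

CITATION HEADER (lean-in-tree rule).  Cell `pub-ymgap` (YM Track A, HUMAN RULING D-0062 ∕ D-0149 width push), DAG node N06 = [B9], width seat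
`pub-ymgap-dag-n06-w4` (g6); a HYPOTHESIS-WEAKENING re-edition of this seat's own `B9Eq325ProjFormulaZdPer` (§2–§4) and `B9Eq325ProjContinuityZdPer` (§2), companion
of `B9Eq325QGGQInvZdPerLevels` (form identity, adjointness, `Q′G′²Q′*` invertible on the bounded hypothesis).  Every proof below is the all-levels proof with the
level bound threaded through; g3's `star_QprimeIter_le` and the lemmas not involving the transporters (`RopPer`, `QprimeVecPer_GpPer_RopPer`,
`qprimeIter_GpPer_RopPer_eq_zero`, `coe_RopPer_eq_covLap`, `deltaPrimeAPerFun_of_ker`, `continuousAt_RopPer`, `covLap_starFun`, …) are cited BY NAME, nothing restated.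

WHAT IS PROVED (kernel, 0 sorry; theorems only).  With `hT : ∀ j, j ≤ m → ∀ z y, bgT L U₀ j z y ∈ unitaryUnits 𝔸` in place of the all-levels hypothesis:
* §1 `QT_congr_of_le` (`Q′ᵀ` reads the multiplier only at the levels `j ≤ m`) · `star_qprimeT1_le` · `star_QprimeT_le` · `star_QT_le` · `penaltyMult_starFun_le` ·
  `deltaPrimeAPerFun_starFun_le` · `starPerSub_deltaPrimeAPer_le` · `starPerSub_GpPer_le` · `starLevPer_QprimeVecPer_le` · `starPerSub_QprimeStarPer_le` ·
  `starLevPer_qggqPer_le` · `starLevPer_cPer_le`.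
* §2 `formPer_deltaPrimeAPer_sub_RopPer_le` (`f − Rf ⊥ Δ′_aλ` for `Q′λ = 0`) · `starPerSub_RopPer_le` · `isSelfAdjoint_lam0Per_le`.
* §3 ★★★ `projEPer_eq_RopPer_of_herm_le` ((3.25) for the record's `projEPer` on Hermitian inputs) · ★★ `coe_projRPer_eq_RopPer_of_herm_le`.
* §4 ★★★ `continuousAt_projRPer_of_herm_le` · ★★ `continuousAt_covDerivFwd_projRPer_covDivB_le` (the `DRD*` letter of the genuine periodic record is continuous in
  the background along unitary periodic families with `Ū₀ʲ(Γ)` unitary for `j ≤ m`, in the regime).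

HONEST SCOPE.  Algebra and finite-dimensional continuity only (the same computations as the all-levels files); no estimate; count-neutral; N05 ∕ N06 NOT
discharged; K1⁹ `stmt-QuantumFields-27364` NOT closed; one finite `𝕋⁴` programme at fixed `ε`, Bałaban as printed; R4 closes only the conditional finite-`𝕋⁴`
rung `BalabanLadder.UV` — nothing continuum ∕ ℝ⁴ ∕ OS ∕ mass gap ∕ Clay.  Unit `pub-ymgap-dag-n06-w4` (g6), 2026-08-28.
-/

noncomputable section

namespace Literature.MathematicalPhysics.QuantumFieldTheory.Balaban1983to89.B9Eq325ProjFormulaZdPerLevels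

open Filter Topology
open B7Prop1Explicit B7Eq78Linearization
open B7Prop2Explicit (unitaryUnits)
open B8Eq119TwistedAxial (bgT)
open B8Ineq132 (covDerivFwd)
open B8Eq138LandauZd (covDivB covLap qprimeT1 QprimeT QT)
open T4TermwiseTorus (IsPeriodic box mem_box tcls tlift tlift_mem_box tlift_tcls_of_mem_box)
open B9Eq321LandauProjectionZd (star_conjR_of_mem_unitaryUnits)
open B9Eq321LandauProjectionZdPer (perSub formPer formPer_apply formPer_isSymm perRestrict perRestrict_mem_perSub perRestrict_eq_self
  rangeSubPer projEPer projRPer isCompl_rangeSubPer_orthogonal projEPer_eq_projection)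
open B9Eq324DeltaPrimeAZdPer (penaltyMult deltaPrimeAPerFun deltaPrimeAPerFun_apply deltaPrimeAPer deltaPrimeAPer_coe_apply deltaPrimeAPer_coe GpPer
  RegularPrimePer deltaPrimeAPer_GpPer formPer_GpPer_symm)
open B9Eq325QGGQInvZdPer (levPer QprimeVecPer QprimeVecPer_apply QprimeStarPer QprimeStarPer_coe qggqPer qggqPer_apply QprimeStarPerInjective cPer
  qggqPer_cPer)
open B9Eq325QGGQInvZdPerLevels (formPer_deltaPrimeAPer_symm_le formPer_qprimeStarPer_le qggqPer_bijective_le)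
open B9Eq325ProjFormulaZd (starFun starFun_apply covLap_starFun)
open B9Eq325ProjFormulaZdLevels (star_QprimeIter_le)
open B9Eq325ProjFormulaZdPer (starPerSub coe_starPerSub starLevPer coe_starLevPer RopPer RopPer_def qprimeIter_GpPer_RopPer_eq_zero coe_RopPer_eq_covLap
  deltaPrimeAPerFun_of_ker)
open B9Eq325ProjContinuityZdPer (continuousAt_perSub_iff continuousAt_RopPer)
open B9Eq325ProjContinuityZd (continuousAt_covDerivFwd continuousAt_covDivB)

-- `Site` alone could resolve to the torus sites of `Setup.lean`; re-export the `ℤ^d` sites of `B7Prop1Explicit`.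
export B7Prop1Explicit (Site)

variable {d : ℕ} {𝔸 : Type*} [CStarAlgebra 𝔸]

/-! ## §1  `*`-compatibility of the transpose stencils, `Δ′_a`, `G′`, `Q′`, `Q′*`, `Q′G′²Q′*`, `(Q′G′²Q′*)⁻¹` with the transporters unitary up to level `m` -/

section Compat

variable {L : ℕ} {U₀ : Site d → Fin d → 𝔸ˣ} {η : ℝ} {m : ℕ} {a : ℕ → ℝ} {Λs : ℕ → Set (Site d)} {P : ℕ}

/-- **`Q′(U₀)ᵀ` READS THE MULTIPLIER ONLY AT THE LEVELS `j ≤ m`**: multipliers agreeing there have the same transpose.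
[cite: Balaban1985BackgroundPropagators, (3.24) p.394 (bookkeeping)] -/
theorem QT_congr_of_le {μ μ' : ℕ → Site d → 𝔸} (h : ∀ j, j ≤ m → μ j = μ' j) (x : Site d) : QT L m Λs U₀ μ x = QT L m Λs U₀ μ' x := by
  unfold QT
  refine Finset.sum_congr rfl fun j hj => ?_
  rw [h j (Nat.lt_succ_iff.1 (Finset.mem_range.1 hj))]

/-- **THE ONE-STEP TRANSPOSE AT A LEVEL `j ≤ m` COMMUTES WITH `*`** (`(R(u)a)* = R(u)a*` for unitary `u`, real weights).
[cite: Balaban1985BackgroundPropagators, (3.19) p.393; Balaban1985Averaging, Prop. 2 p.26] -/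
theorem star_qprimeT1_le (hT : ∀ j, j ≤ m → ∀ (z y : Site d), bgT L U₀ j z y ∈ unitaryUnits 𝔸) {j : ℕ} (hj : j ≤ m) (ν : Site d → 𝔸) (x : Site d) :
    star (qprimeT1 L U₀ j ν x) = qprimeT1 L U₀ j (starFun ν) x := by
  rw [qprimeT1, qprimeT1, star_smul, star_trivial, star_conjR_of_mem_unitaryUnits ((unitaryUnits 𝔸).inv_mem (hT j hj _ x)), starFun_apply]

/-- **`Q′_j(U₀)ᵀ` COMMUTES WITH `*` FOR `j ≤ m`** (it reads `Ū₀⁰, …, Ū₀ʲ⁻¹` only). [cite: Balaban1985BackgroundPropagators, (3.19) p.393, (3.24) p.394] -/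
theorem star_QprimeT_le (hT : ∀ j, j ≤ m → ∀ (z y : Site d), bgT L U₀ j z y ∈ unitaryUnits 𝔸) :
    ∀ (j : ℕ), j ≤ m → ∀ (ν : Site d → 𝔸) (x : Site d), star (QprimeT L U₀ j ν x) = QprimeT L U₀ j (starFun ν) x := by
  intro j
  induction j with
  | zero => intro _ ν x; rfl
  | succ j ih =>
    intro hj ν x
    have hj' : j ≤ m := Nat.le_of_succ_le hj
    show star (QprimeT L U₀ j (qprimeT1 L U₀ j ν) x) = QprimeT L U₀ j (qprimeT1 L U₀ j (starFun ν)) x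
    rw [ih hj']
    congr 1
    funext y
    exact (star_qprimeT1_le hT hj' ν y).symm ▸ rfl

/-- **`Q′(U₀)ᵀμ` COMMUTES WITH `*`** (levelwise involution of the multiplier; indicators commute with `*`; only the levels `j ≤ m` enter).
[cite: Balaban1985BackgroundPropagators, (3.24) p.394] -/
theorem star_QT_le (hT : ∀ j, j ≤ m → ∀ (z y : Site d), bgT L U₀ j z y ∈ unitaryUnits 𝔸) (μ : ℕ → Site d → 𝔸) (x : Site d) :
    star (QT L m Λs U₀ μ x) = QT L m Λs U₀ (fun j => starFun (μ j)) x := by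
  rw [QT, QT, star_sum]
  refine Finset.sum_congr rfl fun j hj => ?_
  rw [star_QprimeT_le hT j (Nat.lt_succ_iff.1 (Finset.mem_range.1 hj))]
  congr 1
  funext y
  by_cases hy : y ∈ Λs j
  · rw [starFun_apply, Set.indicator_of_mem hy, Set.indicator_of_mem hy, starFun_apply]
  · rw [starFun_apply, Set.indicator_of_notMem hy, Set.indicator_of_notMem hy, star_zero]

/-- the penalty multiplier of `f*` at a level `j ≤ m` is the involution of that of `f` (g3's `star_QprimeIter_le`, real weights).
[cite: Balaban1985BackgroundPropagators, (3.24) p.394 (bookkeeping)] -/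
theorem penaltyMult_starFun_le (hT : ∀ j, j ≤ m → ∀ (z y : Site d), bgT L U₀ j z y ∈ unitaryUnits 𝔸) (f : Site d → 𝔸) {j : ℕ} (hj : j ≤ m) :
    penaltyMult L U₀ a (starFun f) j = starFun (penaltyMult L U₀ a f j) := by
  funext y
  simp only [penaltyMult, starFun_apply, star_smul, star_trivial, star_QprimeIter_le hT f j hj y]

/-- ★ **`Δ′_a(U₀)(f*) = (Δ′_a(U₀)f)*`** for the torus stencil (unitary `U₀`, `Ū₀ʲ(Γ)` unitary for `j ≤ m`).
[cite: Balaban1985BackgroundPropagators, (3.24) p.394] -/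
theorem deltaPrimeAPerFun_starFun_le (hU : ∀ (x : Site d) (κ : Fin d), U₀ x κ ∈ unitaryUnits 𝔸)
    (hT : ∀ j, j ≤ m → ∀ (z y : Site d), bgT L U₀ j z y ∈ unitaryUnits 𝔸) (f : Site d → 𝔸) :
    deltaPrimeAPerFun L U₀ η m a Λs (starFun f) = starFun (deltaPrimeAPerFun L U₀ η m a Λs f) := by
  funext x
  rw [deltaPrimeAPerFun_apply, starFun_apply, deltaPrimeAPerFun_apply, star_add, covLap_starFun hU, starFun_apply, star_QT_le hT]
  congr 1
  exact QT_congr_of_le (fun j hj => penaltyMult_starFun_le hT f hj) x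

/-- **`Δ′_a(U₀)` ON `L²(T_P, ·)` COMMUTES WITH THE INVOLUTION** (unitary bonds, `Ū₀ʲ(Γ)` unitary for `j ≤ m`).
[cite: Balaban1985BackgroundPropagators, (3.24) p.394] -/
theorem starPerSub_deltaPrimeAPer_le (hU : ∀ (x : Site d) (κ : Fin d), U₀ x κ ∈ unitaryUnits 𝔸)
    (hT : ∀ j, j ≤ m → ∀ (z y : Site d), bgT L U₀ j z y ∈ unitaryUnits 𝔸) (f : perSub (𝔸 := 𝔸) (d := d) P) :
    deltaPrimeAPer L U₀ η m a Λs P (starPerSub f) = starPerSub (deltaPrimeAPer L U₀ η m a Λs P f) := by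
  apply Subtype.ext
  funext x
  rw [deltaPrimeAPer_coe_apply, coe_starPerSub, coe_starPerSub, deltaPrimeAPerFun_starFun_le hU hT, starFun_apply, starFun_apply,
    deltaPrimeAPer_coe_apply]

/-- ★ **`G′(U₀)(f*) = (G′(U₀)f)*`** in the regime (`Ū₀ʲ(Γ)` unitary for `j ≤ m`). [cite: Balaban1985BackgroundPropagators, (3.24)–(3.25) p.394] -/
theorem starPerSub_GpPer_le (hU : ∀ (x : Site d) (κ : Fin d), U₀ x κ ∈ unitaryUnits 𝔸)
    (hT : ∀ j, j ≤ m → ∀ (z y : Site d), bgT L U₀ j z y ∈ unitaryUnits 𝔸) (hreg : RegularPrimePer L U₀ η m a Λs P)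
    (f : perSub (𝔸 := 𝔸) (d := d) P) :
    GpPer L U₀ η m a Λs P (starPerSub f) = starPerSub (GpPer L U₀ η m a Λs P f) := by
  apply hreg.1
  rw [deltaPrimeAPer_GpPer hreg, starPerSub_deltaPrimeAPer_le hU hT, deltaPrimeAPer_GpPer hreg]

/-- **`Q′(f*) = (Q′f)*`** on `L²(T_P, ·) → L²(𝔅_P, ·)` (`Ū₀ʲ(Γ)` unitary for `j ≤ m`; `Q′` vanishes above `m`). [cite: Balaban1985BackgroundPropagators, (3.19) p.393] -/
theorem starLevPer_QprimeVecPer_le (hT : ∀ j, j ≤ m → ∀ (z y : Site d), bgT L U₀ j z y ∈ unitaryUnits 𝔸) (f : perSub (𝔸 := 𝔸) (d := d) P) :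
    QprimeVecPer P L U₀ m Λs (starPerSub f) = starLevPer (QprimeVecPer P L U₀ m Λs f) := by
  classical
  apply Subtype.ext
  funext p
  obtain ⟨j, y⟩ := p
  rw [coe_starLevPer, starFun_apply, QprimeVecPer_apply, QprimeVecPer_apply, coe_starPerSub]
  split_ifs with h
  · rw [star_QprimeIter_le hT _ j h.1]
  · rw [star_zero]

/-- **`Q′*(φ*) = (Q′*φ)*`** (`Ū₀ʲ(Γ)` unitary for `j ≤ m`). [cite: Balaban1985BackgroundPropagators, (3.25) p.394] -/
theorem starPerSub_QprimeStarPer_le (hT : ∀ j, j ≤ m → ∀ (z y : Site d), bgT L U₀ j z y ∈ unitaryUnits 𝔸)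
    (φ : levPer (𝔸 := 𝔸) (d := d) P L m Λs) :
    QprimeStarPer P L U₀ m Λs (starLevPer φ) = starPerSub (QprimeStarPer P L U₀ m Λs φ) := by
  apply Subtype.ext
  funext x
  rw [QprimeStarPer_coe, coe_starPerSub, starFun_apply, QprimeStarPer_coe]
  show QT L m _ U₀ (fun j y => star ((φ : ℕ × Site d → 𝔸) (j, y))) (tlift (tcls P x)) =
    star (QT L m _ U₀ (fun j y => (φ : ℕ × Site d → 𝔸) (j, y)) (tlift (tcls P x)))
  rw [star_QT_le hT]
  rfl

/-- **`Q′G′²Q′*` COMMUTES WITH THE INVOLUTION** (in the regime; `Ū₀ʲ(Γ)` unitary for `j ≤ m`). [cite: Balaban1985BackgroundPropagators, (3.25) p.394] -/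
theorem starLevPer_qggqPer_le (hU : ∀ (x : Site d) (κ : Fin d), U₀ x κ ∈ unitaryUnits 𝔸)
    (hT : ∀ j, j ≤ m → ∀ (z y : Site d), bgT L U₀ j z y ∈ unitaryUnits 𝔸) (hreg : RegularPrimePer L U₀ η m a Λs P)
    (φ : levPer (𝔸 := 𝔸) (d := d) P L m Λs) :
    qggqPer P L U₀ η m a Λs (starLevPer φ) = starLevPer (qggqPer P L U₀ η m a Λs φ) := by
  rw [qggqPer_apply, qggqPer_apply, starPerSub_QprimeStarPer_le hT, starPerSub_GpPer_le hU hT hreg, starPerSub_GpPer_le hU hT hreg,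
    starLevPer_QprimeVecPer_le hT]

/-- ★ **`(Q′G′²Q′*)⁻¹(φ*) = ((Q′G′²Q′*)⁻¹φ)*`** (in the regime, `Q′G′²Q′*` bijective; `Ū₀ʲ(Γ)` unitary for `j ≤ m`). [cite: Balaban1985BackgroundPropagators, (3.25) p.394] -/
theorem starLevPer_cPer_le (hU : ∀ (x : Site d) (κ : Fin d), U₀ x κ ∈ unitaryUnits 𝔸)
    (hT : ∀ j, j ≤ m → ∀ (z y : Site d), bgT L U₀ j z y ∈ unitaryUnits 𝔸) (hreg : RegularPrimePer L U₀ η m a Λs P)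
    (hb : Function.Bijective (qggqPer (𝔸 := 𝔸) (d := d) P L U₀ η m a Λs)) (φ : levPer (𝔸 := 𝔸) (d := d) P L m Λs) :
    cPer P L U₀ η m a Λs (starLevPer φ) = starLevPer (cPer P L U₀ η m a Λs φ) := by
  apply hb.1
  rw [qggqPer_cPer hb, starLevPer_qggqPer_le hU hT hreg, qggqPer_cPer hb]

end Compat

/-! ## §2  The Lagrange-multiplier algebra on the bounded hypothesis -/

section Lagrange

variable (τ : 𝔸 →ₗ[ℂ] ℂ) {P L : ℕ} [NeZero P] [NeZero L] {U₀ : Site d → Fin d → 𝔸ˣ} {η : ℝ} {m : ℕ} {a : ℕ → ℝ} {Λs : ℕ → Set (Site d)}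

/-- ★ **`f − Rf ⊥ Δ′_a(U₀)λ` FOR EVERY `λ` ANNIHILATED BY `Q′`** (unitary periodic `U₀`, `Ū₀ʲ(Γ)` unitary for `j ≤ m`, `Lᵐ ∣ P`, in the regime):
`⟨Δ′_aλ, G′Q′*ψ⟩ = ⟨λ, Q′*ψ⟩ = ⟨ψ, Q′λ⟩ = 0`. [cite: Balaban1985BackgroundPropagators, (3.21)–(3.22) p.394; Balaban1984PropagatorsI, (1.42)–(1.44) p.25] -/
theorem formPer_deltaPrimeAPer_sub_RopPer_le (hτt : ∀ a b : 𝔸, τ (a * b) = τ (b * a)) (hτs : ∀ a : 𝔸, τ (star a) = starRingEnd ℂ (τ a))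
    (hUu : ∀ (x : Site d) (κ : Fin d), U₀ x κ ∈ unitaryUnits 𝔸) (hT : ∀ j, j ≤ m → ∀ (z y : Site d), bgT L U₀ j z y ∈ unitaryUnits 𝔸)
    (hU : IsPeriodic P U₀) (hP : L ^ m ∣ P) (hreg : RegularPrimePer L U₀ η m a Λs P) (lam : perSub (𝔸 := 𝔸) (d := d) P)
    (hQ : QprimeVecPer P L U₀ m Λs lam = 0) (f : perSub (𝔸 := 𝔸) (d := d) P) :
    formPer τ P (deltaPrimeAPer L U₀ η m a Λs P lam) (f - RopPer P L U₀ η m a Λs f) = 0 := by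
  rw [RopPer_def, sub_sub_cancel]
  set ψ := cPer P L U₀ η m a Λs (QprimeVecPer P L U₀ m Λs (GpPer L U₀ η m a Λs P f))
  have hΔsymm := fun f g => formPer_deltaPrimeAPer_symm_le τ hτt hτs hUu hT hU hP (η := η) (a := a) (Λs := Λs) f g
  have h1 : formPer τ P (deltaPrimeAPer L U₀ η m a Λs P lam) (GpPer L U₀ η m a Λs P (QprimeStarPer P L U₀ m Λs ψ)) =
      formPer τ P lam (QprimeStarPer P L U₀ m Λs ψ) := by
    rw [(formPer_isSymm τ P hτs).eq, hΔsymm, deltaPrimeAPer_GpPer hreg]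
  rw [h1, (formPer_isSymm τ P hτs).eq, formPer_qprimeStarPer_le τ hτt hτs hT hP, hQ, map_zero]

omit [NeZero P] [NeZero L] in
/-- **`R` COMMUTES WITH THE INVOLUTION** (unitary `U₀`, `Ū₀ʲ(Γ)` unitary for `j ≤ m`, in the regime, `Q′G′²Q′*` bijective): `R(f*) = (Rf)*`.
[cite: Balaban1985BackgroundPropagators, (3.25) p.394] -/
theorem starPerSub_RopPer_le (hUu : ∀ (x : Site d) (κ : Fin d), U₀ x κ ∈ unitaryUnits 𝔸)
    (hT : ∀ j, j ≤ m → ∀ (z y : Site d), bgT L U₀ j z y ∈ unitaryUnits 𝔸)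
    (hreg : RegularPrimePer L U₀ η m a Λs P) (hb : Function.Bijective (qggqPer (𝔸 := 𝔸) (d := d) P L U₀ η m a Λs)) (f : perSub (𝔸 := 𝔸) (d := d) P) :
    RopPer P L U₀ η m a Λs (starPerSub f) = starPerSub (RopPer P L U₀ η m a Λs f) := by
  rw [RopPer_def, RopPer_def, starPerSub_GpPer_le hUu hT hreg f, starLevPer_QprimeVecPer_le hT, starLevPer_cPer_le hUu hT hreg hb,
    starPerSub_QprimeStarPer_le hT, starPerSub_GpPer_le hUu hT hreg]
  apply Subtype.ext
  funext x
  simp only [Submodule.coe_sub, Pi.sub_apply, coe_starPerSub, starFun_apply, star_sub]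

omit [NeZero P] [NeZero L] in
/-- ★ **FOR A HERMITIAN `f`, `λ₀ := G′Rf` IS HERMITIAN-VALUED** (unitary `U₀`, `Ū₀ʲ(Γ)` unitary for `j ≤ m`, in the regime).
[cite: Balaban1985BackgroundPropagators, (3.21)–(3.22) p.394 («L²(Ω₀, 𝔤)»)] -/
theorem isSelfAdjoint_lam0Per_le (hUu : ∀ (x : Site d) (κ : Fin d), U₀ x κ ∈ unitaryUnits 𝔸)
    (hT : ∀ j, j ≤ m → ∀ (z y : Site d), bgT L U₀ j z y ∈ unitaryUnits 𝔸)
    (hreg : RegularPrimePer L U₀ η m a Λs P) (hb : Function.Bijective (qggqPer (𝔸 := 𝔸) (d := d) P L U₀ η m a Λs))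
    {f : perSub (𝔸 := 𝔸) (d := d) P} (hf : starPerSub f = f) (x : Site d) :
    IsSelfAdjoint (((GpPer L U₀ η m a Λs P (RopPer P L U₀ η m a Λs f) : perSub (𝔸 := 𝔸) (d := d) P) : Site d → 𝔸) x) := by
  have h : starPerSub (GpPer L U₀ η m a Λs P (RopPer P L U₀ η m a Λs f)) = GpPer L U₀ η m a Λs P (RopPer P L U₀ η m a Λs f) := by
    rw [← starPerSub_GpPer_le hUu hT hreg, ← starPerSub_RopPer_le hUu hT hreg hb, hf]
  have hx := congrArg (fun g : perSub (𝔸 := 𝔸) (d := d) P => (g : Site d → 𝔸) x) h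
  simp only [coe_starPerSub, starFun_apply] at hx
  exact hx

end Lagrange

/-! ## §3  (3.25) for the record's `R(U₀)` on the torus, Hermitian inputs, transporters unitary up to level `m` -/

section Formula

variable (τ : 𝔸 →ₗ[ℂ] ℂ) {P L : ℕ} [NeZero P] [NeZero L] {U₀ : Site d → Fin d → 𝔸ˣ} {η : ℝ} {m : ℕ} {a : ℕ → ℝ} {Λs : ℕ → Set (Site d)}
  [FiniteDimensional ℝ 𝔸]

/-- ★★★ **(3.25) FOR THE RECORD'S `R(U₀)` ON `L²(T_P, 𝔤)`, HERMITIAN INPUTS, `Ū₀ʲ(Γ)` UNITARY FOR `j ≤ m` ONLY**: for `f ∈ L²(T_P, ·)` with `f* = f`, at every UNITARY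
`P`-periodic background `U₀` whose averaged transporters are unitary up to the truncation level, `L ≥ 1`, `Lᵐ ∣ P`, level-periodic `Λ_j`, tracial Hermitian faithful
`τ` on a finite-dimensional `𝔸`, in the regime (`Δ′_a(U₀)` invertible, `Q′*` injective): `R(U₀)f = f − G′(Q′*((Q′G′²Q′*)⁻¹(Q′(G′f))))`.
[cite: Balaban1985BackgroundPropagators, (3.25) p.394, (3.21)–(3.22) p.394; Balaban1984PropagatorsI, (1.42)–(1.44) p.25; Balaban1985Averaging, Prop. 2 p.26] -/
theorem projEPer_eq_RopPer_of_herm_le (hτt : ∀ a b : 𝔸, τ (a * b) = τ (b * a)) (hτs : ∀ a : 𝔸, τ (star a) = starRingEnd ℂ (τ a))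
    (hτp : ∀ a : 𝔸, a ≠ 0 → 0 < (τ (star a * a)).re) (hL : 1 ≤ L)
    (hUu : ∀ (x : Site d) (κ : Fin d), U₀ x κ ∈ unitaryUnits 𝔸) (hT : ∀ j, j ≤ m → ∀ (z y : Site d), bgT L U₀ j z y ∈ unitaryUnits 𝔸)
    (hU : IsPeriodic P U₀) (hP : L ^ m ∣ P) (hΛ : ∀ j, j ≤ m → IsPeriodic (P / L ^ j) fun y => y ∈ Λs j)
    (hreg : RegularPrimePer L U₀ η m a Λs P) (hinj : QprimeStarPerInjective P L U₀ m Λs)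
    {f : perSub (𝔸 := 𝔸) (d := d) P} (hf : starPerSub f = f) :
    projEPer τ P L m η Λs U₀ f = RopPer P L U₀ η m a Λs f := by
  classical
  have hb : Function.Bijective (qggqPer (𝔸 := 𝔸) (d := d) P L U₀ η m a Λs) := qggqPer_bijective_le τ hτt hτs hτp hUu hT hU hP hreg hinj
  set R := RopPer P L U₀ η m a Λs f with hRdef
  set lam := GpPer L U₀ η m a Λs P R with hlam
  have hc := isCompl_rangeSubPer_orthogonal (P := P) (τ := τ) L m η Λs U₀ hτs hτp
  -- (i) `Rf ∈ Δ^η_{U₀}N_𝔤^per(Q′)`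
  have hmem : R ∈ rangeSubPer P L m η Λs U₀ := by
    refine Submodule.subset_span ⟨(lam : Site d → 𝔸), ⟨?_, lam.2, ?_⟩, ?_⟩
    · exact fun x => isSelfAdjoint_lam0Per_le hUu hT hreg hb hf x
    · intro j hj y hy
      exact qprimeIter_GpPer_RopPer_eq_zero hU hP hΛ hb f hj hy
    · exact coe_RopPer_eq_covLap hL hU hP hΛ hreg hb f
  -- (ii) `f − Rf ⊥ Δ^η_{U₀}N_𝔤^per(Q′)`
  have horth : f - R ∈ (formPer τ P).orthogonal (rangeSubPer P L m η Λs U₀) := by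
    rw [LinearMap.BilinForm.mem_orthogonal_iff]
    intro w hw
    induction hw using Submodule.span_induction with
    | mem w hw =>
      obtain ⟨mu, ⟨_, hper, hQ⟩, hwmu⟩ := hw
      set muS : perSub (𝔸 := 𝔸) (d := d) P := ⟨mu, hper⟩ with hmuS
      have hQvec : QprimeVecPer P L U₀ m Λs muS = 0 := by
        apply Subtype.ext
        funext p
        obtain ⟨j, y⟩ := p
        rw [QprimeVecPer_apply, Submodule.coe_zero, Pi.zero_apply]
        split_ifs with h
        · exact hQ j h.1 _ h.2
        · rfl
      have hw' : w = deltaPrimeAPer L U₀ η m a Λs P muS := by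
        apply Subtype.ext
        rw [hwmu, deltaPrimeAPer_coe η a hL hU hP hΛ muS, deltaPrimeAPerFun_of_ker hQ]
      show formPer τ P w (f - R) = 0
      rw [hw']
      exact formPer_deltaPrimeAPer_sub_RopPer_le τ hτt hτs hUu hT hU hP hreg muS hQvec f
    | zero =>
      show formPer τ P 0 (f - R) = 0
      rw [map_zero, LinearMap.zero_apply]
    | add w₁ w₂ _ _ h₁ h₂ =>
      show formPer τ P (w₁ + w₂) (f - R) = 0
      have e₁ : formPer τ P w₁ (f - R) = 0 := h₁
      have e₂ : formPer τ P w₂ (f - R) = 0 := h₂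
      rw [map_add, LinearMap.add_apply, e₁, e₂, add_zero]
    | smul c w _ hw =>
      show formPer τ P (c • w) (f - R) = 0
      have e : formPer τ P w (f - R) = 0 := hw
      rw [map_smul, LinearMap.smul_apply, e, smul_zero]
  -- (iii) uniqueness of the orthogonal decomposition
  rw [projEPer_eq_projection L m η Λs U₀ hτs hτp]
  have hsplit : f = R + (f - R) := by abel
  conv_lhs => rw [hsplit]
  rw [map_add, Submodule.projection_apply_of_mem_left _ hmem, Submodule.projection_apply_of_mem_right _ horth, add_zero]

/-- ★★ **(3.25) FOR `projRPer` ON A PERIODIC HERMITIAN-VALUED SITE FUNCTION, `Ū₀ʲ(Γ)` UNITARY FOR `j ≤ m` ONLY** (same hypotheses).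
[cite: Balaban1985BackgroundPropagators, (3.25) p.394, (3.21)–(3.22) p.394] -/
theorem coe_projRPer_eq_RopPer_of_herm_le (hτt : ∀ a b : 𝔸, τ (a * b) = τ (b * a)) (hτs : ∀ a : 𝔸, τ (star a) = starRingEnd ℂ (τ a))
    (hτp : ∀ a : 𝔸, a ≠ 0 → 0 < (τ (star a * a)).re) (hL : 1 ≤ L)
    (hUu : ∀ (x : Site d) (κ : Fin d), U₀ x κ ∈ unitaryUnits 𝔸) (hT : ∀ j, j ≤ m → ∀ (z y : Site d), bgT L U₀ j z y ∈ unitaryUnits 𝔸)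
    (hU : IsPeriodic P U₀) (hP : L ^ m ∣ P) (hΛ : ∀ j, j ≤ m → IsPeriodic (P / L ^ j) fun y => y ∈ Λs j)
    (hreg : RegularPrimePer L U₀ η m a Λs P) (hinj : QprimeStarPerInjective P L U₀ m Λs)
    {f : Site d → 𝔸} (hf : IsPeriodic P f) (hsa : ∀ x, IsSelfAdjoint (f x)) :
    projRPer τ P L m η Λs U₀ f = ((RopPer P L U₀ η m a Λs ⟨f, hf⟩ : perSub (𝔸 := 𝔸) (d := d) P) : Site d → 𝔸) := by
  have heq : (⟨perRestrict P f, perRestrict_mem_perSub P f⟩ : perSub (𝔸 := 𝔸) (d := d) P) = ⟨f, hf⟩ := Subtype.ext (perRestrict_eq_self P hf)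
  have hstar : starPerSub (⟨f, hf⟩ : perSub (𝔸 := 𝔸) (d := d) P) = ⟨f, hf⟩ := by
    apply Subtype.ext
    funext x
    exact (hsa x).star_eq
  rw [projRPer, heq, projEPer_eq_RopPer_of_herm_le τ hτt hτs hτp hL hUu hT hU hP hΛ hreg hinj hstar]

end Formula

/-! ## §4  The record's `R(U)` on the torus is continuous in the background on Hermitian inputs (transporters unitary up to level `m`) -/

section Projection

variable {Z : Type*} [TopologicalSpace Z] {z₀ : Z}
variable (τ : 𝔸 →ₗ[ℂ] ℂ) {P L : ℕ} [NeZero P] [NeZero L] {m : ℕ} {Λs : ℕ → Set (Site d)} (η : ℝ) (a : ℕ → ℝ) [FiniteDimensional ℝ 𝔸]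
  {U : Z → Site d → Fin d → 𝔸ˣ} (hU : ContinuousAt U z₀)
  (hbgT : ∀ j, j < m + 1 → ∀ (y x : Site d), ContinuousAt (fun z => bgT L (U z) j y x) z₀)

include hU hbgT in
/-- ★★★ **THE RECORD's LANDAU PROJECTION `R(U)` ON `L²(T_P, 𝔤)`, APPLIED TO A CONTINUOUS PERIODIC HERMITIAN FAMILY, IS CONTINUOUS IN THE BACKGROUND** — along any
family of UNITARY `P`-periodic backgrounds whose averaged transporters `Ū_zʲ(Γ)` are unitary FOR `j ≤ m` (the levels `Q′` reads; [B7] Prop. 2's output on a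
small-field class), `L ≥ 1`, `Lᵐ ∣ P`, level-periodic `Λ_j`, in the regime (`Δ′_a(U_z)` invertible, `Q′*` injective), faithful Hermitian tracial `τ`, finite-dimensional
fibre: for `g_z` `P`-periodic, Hermitian-valued, with continuous site values, `z ↦ (R(U_z)g_z)(x)` is continuous at `z₀`.
[cite: Balaban1985BackgroundPropagators, (3.21)–(3.22) p.394, (3.25) p.394; Balaban1985Averaging, Prop. 2 p.26; Balaban1985RegularSpaces, p.77 («Ω_j = T_η»)] -/
theorem continuousAt_projRPer_of_herm_le (hτt : ∀ a b : 𝔸, τ (a * b) = τ (b * a)) (hτs : ∀ a : 𝔸, τ (star a) = starRingEnd ℂ (τ a))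
    (hτp : ∀ a : 𝔸, a ≠ 0 → 0 < (τ (star a * a)).re) (hL : 1 ≤ L)
    (hUu : ∀ (z : Z) (x : Site d) (κ : Fin d), U z x κ ∈ unitaryUnits 𝔸)
    (hT : ∀ (z : Z) (j : ℕ), j ≤ m → ∀ (x y : Site d), bgT L (U z) j x y ∈ unitaryUnits 𝔸)
    (hUper : ∀ z, IsPeriodic P (U z)) (hP : L ^ m ∣ P) (hΛ : ∀ j, j ≤ m → IsPeriodic (P / L ^ j) fun y => y ∈ Λs j)
    (hreg : ∀ z, RegularPrimePer L (U z) η m a Λs P) (hinj : ∀ z, QprimeStarPerInjective (𝔸 := 𝔸) (d := d) P L (U z) m Λs)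
    {g : Z → Site d → 𝔸} (hg : ∀ x : Site d, ContinuousAt (fun z => g z x) z₀) (hgper : ∀ z, IsPeriodic P (g z))
    (hherm : ∀ (z : Z) (x : Site d), IsSelfAdjoint (g z x)) (x : Site d) :
    ContinuousAt (fun z => projRPer τ P L m η Λs (U z) (g z) x) z₀ := by
  have hb : ∀ z, Function.Bijective (qggqPer (𝔸 := 𝔸) (d := d) P L (U z) η m a Λs) :=
    fun z => qggqPer_bijective_le τ hτt hτs hτp (hUu z) (hT z) (hUper z) hP (hreg z) (hinj z)
  let F : Z → perSub (𝔸 := 𝔸) (d := d) P := fun z => ⟨g z, hgper z⟩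
  have hF : ContinuousAt F z₀ := by
    rw [continuousAt_perSub_iff]
    exact hg
  have hR := continuousAt_RopPer (hU := hU) (hbgT := hbgT) η a hP hreg hb hF
  have hRx : ContinuousAt (fun z => ((RopPer P L (U z) η m a Λs (F z) : perSub (𝔸 := 𝔸) (d := d) P) : Site d → 𝔸) x) z₀ :=
    continuousAt_perSub_iff.1 hR x
  refine hRx.congr (Eventually.of_forall fun z => ?_)
  show _ = projRPer τ P L m η Λs (U z) (g z) x
  rw [coe_projRPer_eq_RopPer_of_herm_le τ hτt hτs hτp hL (hUu z) (hT z) (hUper z) hP hΛ (hreg z) (hinj z) (hgper z) (hherm z) (a := a)]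

include hU hbgT in
/-- ★★ **THE `DRD*` LETTER ON THE TORUS IS CONTINUOUS IN THE BACKGROUND, `Ū_zʲ(Γ)` UNITARY FOR `j ≤ m` ONLY**: for a periodic Hermitian bond field `A`,
`z ↦ (D^η_{U_z,μ} R(U_z) D^{η*}_{U_z} A)(x)` is continuous at `z₀` under the hypotheses of `continuousAt_projRPer_of_herm_le` — the letter `DRDs` of the genuine
periodic record. [cite: Balaban1985BackgroundPropagators, (3.26) p.395 («D^η_U R(U) D^{η*}_U»), (3.25) p.394; Balaban1985Averaging, Prop. 2 p.26] -/
theorem continuousAt_covDerivFwd_projRPer_covDivB_le (hτt : ∀ a b : 𝔸, τ (a * b) = τ (b * a)) (hτs : ∀ a : 𝔸, τ (star a) = starRingEnd ℂ (τ a))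
    (hτp : ∀ a : 𝔸, a ≠ 0 → 0 < (τ (star a * a)).re) (hL : 1 ≤ L)
    (hUu : ∀ (z : Z) (x : Site d) (κ : Fin d), U z x κ ∈ unitaryUnits 𝔸)
    (hT : ∀ (z : Z) (j : ℕ), j ≤ m → ∀ (x y : Site d), bgT L (U z) j x y ∈ unitaryUnits 𝔸)
    (hUper : ∀ z, IsPeriodic P (U z)) (hP : L ^ m ∣ P) (hΛ : ∀ j, j ≤ m → IsPeriodic (P / L ^ j) fun y => y ∈ Λs j)
    (hreg : ∀ z, RegularPrimePer L (U z) η m a Λs P) (hinj : ∀ z, QprimeStarPerInjective (𝔸 := 𝔸) (d := d) P L (U z) m Λs)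
    {A : Site d → Fin d → 𝔸} (hA : IsPeriodic P A) (hAh : ∀ (y : Site d) (μ : Fin d), IsSelfAdjoint (A y μ)) (μ : Fin d) (x : Site d) :
    ContinuousAt (fun z => covDerivFwd η (U z) μ (projRPer τ P L m η Λs (U z) (covDivB η (U z) A)) x) z₀ := by
  have hproj : ∀ y : Site d, ContinuousAt (fun z => projRPer τ P L m η Λs (U z) (covDivB η (U z) A) y) z₀ := by
    intro y
    refine continuousAt_projRPer_of_herm_le τ η a hU hbgT hτt hτs hτp hL hUu hT hUper hP hΛ hreg hinj (g := fun z => covDivB η (U z) A)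
      (fun x' => continuousAt_covDivB hU η x' fun _ _ => continuousAt_const) (fun z => B9Eq321LandauProjectionZdPer.isPeriodic_covDivB (hUper z) hA)
      (fun z x' => B9Eq325ProjContinuityZd.isSelfAdjoint_covDivB η (hUu z) hAh x') y
  exact continuousAt_covDerivFwd hU η μ x (hproj _) (hproj x)

end Projection

end Literature.MathematicalPhysics.QuantumFieldTheory.Balaban1983to89.B9Eq325ProjFormulaZdPerLevels
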